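/-
Copyright (c) 2026 the pub-hodgecm-mathlib formalisation cell (harness21).  Prover seat hodgecm-mathlib-K2E3-p06 (g2), Track B «K2-LIT» ∕ h413,
ENGINE E3 unit U4 «Keys», SIGS-TABLE row #6 `sig_K2E3IrregularReducibleCaseThree` — analytic letter hKP, brick F5 (KEYS' PLANCHEREL NON-VANISHING on a local field
with involution).
-/
import Summits.HodgeConjecture.HodgeConjecture.Theorems.K2E3TateZetaFubiniAtZero         -- ★ brick F1 (this seat): Tate's Lemma 2.4.2 at `s = 0`
import Summits.HodgeConjecture.HodgeConjecture.Theorems.K2E3SkewLineZetaLimit              -- ★ brick F3b (this seat): `Z(g_T, χ, 0) → C_Φ · J`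
import Summits.HodgeConjecture.HodgeConjecture.Theorems.K2E3KeysSkewLineTestFunctions     -- ★ brick F5a (this seat): `χ̃`, the two-bump test functions; brings ★ F4c
import HarnessLib

/-!
# K2 · E3 · U4 «Keys», row #6 — brick F5: KEYS' PLANCHEREL NON-VANISHING on a non-archimedean local field `E` with a continuous isometric involution `σ` —
# for a quasi-character `χ` of `Eˣ` with `χ(σu · u) = 1` that is non-trivial on some `σ`-fixed unit, `∫_{E⁻} ‖1+η‖⁻¹ χ̃(1+η) dμ⁻(η) ≠ 0` [Keys1984 §5, §7 Thm. (1); Tate1950 §2.4]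

Cell `pub/hodgecm-mathlib` (D-0151), HCML Track B «K2-LIT», crux H413 = `stmt-HodgeConjecture-24833` (lane `--supports … --as helper`), route
HCCMUnconditional; socket `sig_K2E3IrregularReducibleCaseThree` (U4-c) of `Cruxes/H413/Lines/K2_E3_EllipticInputsSigs_U4Keys.lean`.
THEOREMS ONLY (0 def ∕ 0 instance ∕ 0 notation ∕ 0 sorry); ★-only imports.

THE MATHEMATICS (Tate's Fubini trick read at `s = 0`).  `χ` is unitary (`|χ(σu)χ(u)| = 1` and `σ` is an isometry), so `s = 0` is the boundary of Tate's strip; but for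
test functions vanishing near `0` both zeta integrals at `s = 0` converge and ★ F1 gives `Z(f,χ,0) Z(ĝ_T,χ⁻¹,1) = Z(f̂,χ⁻¹,1) Z(g_T,χ,0)` (`d×x = ‖x‖⁻¹dx`, ★ `tateZeta_unitsMeasure`).
Take `f = 𝟙_{1+𝔭^M}` (`Z(f,χ,0) = μ×(U^M) ≠ 0`), the `σ`-even character `ψ(x) = ψ₀(x₀(x+σx))` (★ F4) and `g_T(x) = Φ(Re x)𝟙[‖Im x‖ ≤ T]` with the two-bump
`Φ(a) = ψ(−a)𝟙_B(a) − ψ(−c₀a)𝟙_B(c₀a)`, `χ(c₀) = −1` (★ F4b).  Then `Z(ĝ_T,χ⁻¹,1) = μ⁻(B_T)μ⁻(Ann_T) · 2μ⁺(B)μ⁺(𝔞)` (★ F4c), bounded below along `T_k = ‖l‖^k T₀`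
(★ F4c §3), while `Z(g_{T_k},χ,0) → C_Φ · J` with `J = ∫_{E⁻} ‖1+η‖⁻¹ χ̃(1+η) dμ⁻` (★ F3 ∕ F3b).  If `J = 0` the right side tends to `0` and the left does not: contradiction.
No Gauss sum is evaluated and no case distinction by ramification (dyadic places included) is made.
* **`integral_skewLine_extend_ne_zero`** — THE THEOREM (one long assembly; every analytic step is a ★ brick F1–F5a of this seat).
HONEST LABEL: HC_CM is proved only modulo the 7 printed citations (2 remaining named inputs: hLiu418 = `stmt-HodgeConjecture-24832`, h413 =
`stmt-HodgeConjecture-24833`) until rung 0 closes; this file is the analytic letter hKP of row #6 in the currency of an abstract local field `(E, σ)`; brick F6 transports it to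
`LocalRing L v` at a non-split place and closes the socket with ★ p855477.

## References
* [Keys1984] D. Keys, *Principal series representations of special unitary groups over local fields*, Compositio Math. 51 (1984), §5 (Plancherel measure of the unitary
  principal series), §7 Thm. (1) p. 126.
* [Tate1950] J. Tate, *Fourier analysis in number fields and Hecke's zeta-functions* (1950), §2.4 Lemma 2.4.2–2.4.3, §2.5.
* [Rogawski1990] J. D. Rogawski, *Automorphic Representations of Unitary Groups in Three Variables*, Ann. of Math. Stud. 123 (1990), §12.2 (3) pp. 173–174.
-/

set_option autoImplicit false
-- the mandated namespace has the single-problem summit's repeated segment (`HodgeConjecture.HodgeConjecture`)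
set_option linter.dupNamespace false

noncomputable section

open scoped NNReal ENNReal Topology Pointwise
open MeasureTheory Filter Set
open Literature.NumberTheory.GaloisRepresentations.IsNonarchimedeanLocalField
open Literature.NumberTheory.Automorphic
open Literature.NumberTheory.Automorphic.TateDirect
open Literature.NumberTheory.Automorphic.UnitaryGroup.HeisRing
open Summit.HodgeConjecture.HodgeConjecture.Cruxes.H413.K2E3TateZetaFubiniAtZero
open Summit.HodgeConjecture.HodgeConjecture.Cruxes.H413.K2E3SkewLineIntegrable
open Summit.HodgeConjecture.HodgeConjecture.Cruxes.H413.K2E3SkewLineZetaFibration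
open Summit.HodgeConjecture.HodgeConjecture.Cruxes.H413.K2E3SkewLineZetaLimit
open Summit.HodgeConjecture.HodgeConjecture.Cruxes.H413.K2E3SigmaEvenCharacter
open Summit.HodgeConjecture.HodgeConjecture.Cruxes.H413.K2E3TwoBumpTransform
open Summit.HodgeConjecture.HodgeConjecture.Cruxes.H413.K2E3DualZetaEvaluation
open Summit.HodgeConjecture.HodgeConjecture.Cruxes.H413.K2E3KeysSkewLineTestFunctions

namespace Summit.HodgeConjecture.HodgeConjecture.Cruxes.H413.K2E3KeysSkewLineNonvanishingLocal

variable {E : Type*} [Field E] [ValuativeRel E] [TopologicalSpace E] [IsNonarchimedeanLocalField E]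
  (σ : E →+* E) (hσ : ∀ x, σ (σ x) = x) (hσc : Continuous σ) [Invertible (2 : E)]
  (hσn : ∀ x, normAbs E (σ x) = normAbs E x)

variable [MeasurableSpace E] [BorelSpace E]

include hσ hσc hσn in
/-- **KEYS' PLANCHEREL NON-VANISHING (analytic letter hKP of row #6), on a local field with involution.**  Let `E` be a non-archimedean local field, `σ` a continuous
involution with `‖σx‖ = ‖x‖`, `2 ∈ Eˣ`, `δ` a `σ`-skew unit, `ψ₀` a non-trivial continuous additive character, `χ` a quasi-character of `Eˣ` with `χ(σu · u) = 1` for all `u`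
and `χ(c₀) ≠ 1` for some `σ`-fixed unit `c₀`.  Then for every regular Haar measure `μ⁻` of `E⁻ = {σ η = −η}`,
`∫_{E⁻} ‖1+η‖⁻¹ • χ̃(1+η) dμ⁻(η) ≠ 0`  (`χ̃` = `χ` extended by zero).  Proof: Tate's Fubini trick at `s = 0` (★ F1) with `f = 𝟙_{1+𝔭^M}` and the truncated two-bump test
functions `g_{T_k}` (★ F4b); the left side `μ×(U^M) · μ⁻(B_{T_k})μ⁻(Ann_{T_k}) · 2μ⁺(B)μ⁺(𝔞)` (★ F4c) stays bounded below, the right side `Z(f̂,χ⁻¹,1) · Z(g_{T_k},χ,0)` would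
tend to `0` if the skew-line integral vanished (★ F3b).  [cite: Keys1984, §5; §7 Thm. (1) p. 126] [cite: Tate1950, §2.4, Lemma 2.4.2] [cite: Rogawski1990, §12.2 (3) pp. 173–174] -/
theorem integral_skewLine_extend_ne_zero [T2Space E] [SecondCountableTopology E] (δ : Eˣ) (hδ : σ (δ : E) = -δ)
    (ψ₀ : AddChar E Circle) (hψ₀ : ψ₀.IsContinuousNontrivial)
    (χ : QuasiChar E) (hχσ : ∀ u : Eˣ, χ (Units.map (σ : E →* E) u) * χ u = 1)
    (c₀ : Eˣ) (hc₀ : σ (c₀ : E) = c₀) (hχc₀ : χ c₀ ≠ 1)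
    (μm : Measure (skewPart σ)) [μm.IsAddHaarMeasure] [μm.Regular] :
    ∫ η : skewPart σ, (((normAbs E (1 + (η : E)))⁻¹ : ℝ≥0)) •
        Function.extend ((↑) : Eˣ → E) (fun u => ((χ u : ℂˣ) : ℂ)) 0 (1 + (η : E)) ∂μm ≠ 0 := by
  intro hJ
  haveI := locallyCompactSpace_fixedPart σ hσc
  haveI := locallyCompactSpace_skewPart σ hσc
  haveI : SecondCountableTopology (fixedPart σ) := TopologicalSpace.Subtype.secondCountableTopology _
  haveI : SecondCountableTopology (skewPart σ) := TopologicalSpace.Subtype.secondCountableTopology _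
  have h2 : (⅟(2 : E)) * 2 = 1 := invOf_mul_self _
  have hq1 : (residueFieldCard E : ℝ≥0)⁻¹ < 1 := inv_residueFieldCard_lt_one
  have hq0 : 0 < (residueFieldCard E : ℝ≥0)⁻¹ := inv_residueFieldCard_pos
  ---------------------------------------------------------------- §A the character `χ` extended by zero and its inverse
  have hχ0 : χ.HasExponent 0 := hasExponent_zero_of_conj_mul σ hσn χ hχσ
  have hχ0' : (χ⁻¹).HasExponent 0 := by have h := hχ0.inv; rwa [neg_zero] at h
  set D : E → ℂ := Function.extend ((↑) : Eˣ → E) (fun u => ((χ u : ℂˣ) : ℂ)) 0 with hDdef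
  set Dbar : E → ℂ := Function.extend ((↑) : Eˣ → E) (fun u => ((χ⁻¹ u : ℂˣ) : ℂ)) 0 with hDbardef
  have hDm : Measurable D := measurable_extend χ
  have hDbarm : Measurable Dbar := measurable_extend χ⁻¹
  have hDb : ∀ b, ‖D b‖ ≤ 1 := norm_extend_le_one χ hχ0
  have hDbarb : ∀ b, ‖Dbar b‖ ≤ 1 := norm_extend_le_one χ⁻¹ hχ0'
  have hDmul : ∀ a b, D (a * b) = D a * D b := extend_mul_all χ
  have hDbarmul : ∀ a b, Dbar (a * b) = Dbar a * Dbar b := extend_mul_all χ⁻¹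
  obtain ⟨M₀, hM₀⟩ := QuasiChar.exists_hasConductorExp χ
  set M : ℕ := max M₀ 1 with hMdef
  have hM1 : 1 ≤ M := le_max_right _ _
  have hχM : ∀ x ∈ unitFiltration E M, χ x = 1 := fun x hx => hM₀.1 x (unitFiltration_antitone (le_max_left _ _) hx)
  have hχM' : ∀ x ∈ unitFiltration E M, χ⁻¹ x = 1 := fun x hx => by
    change (χ x)⁻¹ = 1; rw [hχM x hx, inv_one]
  set r₁ : ℝ≥0 := ((residueFieldCard E : ℝ≥0)⁻¹) ^ (M : ℤ) with hr₁def
  have hr₁ : 0 < r₁ := zpow_pos hq0 _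
  have hD1 : ∀ t : E, normAbs E t ≤ r₁ → D (1 + t) = 1 := fun t ht => extend_one_add_eq_one χ hM1 hχM t ht
  have hDbar1 : ∀ t : E, normAbs E t ≤ r₁ → Dbar (1 + t) = 1 := fun t ht => extend_one_add_eq_one χ⁻¹ hM1 hχM' t ht
  have hDbarc₀ : Dbar (c₀ : E) = -1 := extend_inv_apply_eq_neg_one σ χ hχσ c₀ hc₀ hχc₀
  ---------------------------------------------------------------- §B the `σ`-even additive character `ψ(x) = ψ₀(x₀ (x + σ x))`
  obtain ⟨x₀, hx₀⟩ : ∃ x₀ : E, ψ₀ x₀ ≠ 1 := by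
    obtain ⟨x, hx⟩ := DFunLike.ne_iff.1 hψ₀.2; exact ⟨x, by rwa [AddChar.zero_apply] at hx⟩
  set τ : E →+ E := (AddMonoidHom.mulLeft x₀).comp ((AddMonoidHom.id E) + (σ : E →+* E).toAddMonoidHom) with hτdef
  set ψ : AddChar E Circle := ψ₀.compAddMonoidHom τ with hψdef
  have hψapply : ∀ x, ψ x = ψ₀ (x₀ * (x + σ x)) := fun x => rfl
  have hψc : Continuous ψ := by
    have h : Continuous fun x : E => ψ₀ (x₀ * (x + σ x)) := hψ₀.1.comp (continuous_const.mul (continuous_id.add hσc))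
    exact h.congr fun x => (hψapply x).symm
  have hψσ : ∀ x, ψ (σ x) = ψ x := fun x => by rw [hψapply, hψapply, hσ, add_comm]
  have hψ1 : ψ ≠ 0 := by
    intro h
    apply hx₀
    have := DFunLike.congr_fun h (⅟(2 : E))
    rw [AddChar.zero_apply, hψapply, map_invOf_two σ, invOf_two_add_invOf_two, mul_one] at this
    exact this
  have hψ : ψ.IsContinuousNontrivial := ⟨hψc, hψ1⟩
  obtain ⟨mψ, hmψ⟩ := hψ.exists_hasConductorExp
  set rψ : ℝ≥0 := ((residueFieldCard E : ℝ≥0)⁻¹) ^ mψ with hrψdef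
  have hrψ0 : 0 < rψ := zpow_pos hq0 _
  have hrψ : ∀ z : E, normAbs E z ≤ rψ → ψ z = 1 := fun z hz => hmψ.1 z hz
  obtain ⟨a₁, ha₁, ha₁0, hψa₁⟩ := exists_fixed_addChar_ne_one σ hσ ψ hψσ hψ1
  have hna₁ : 0 < normAbs E a₁ := pos_iff_ne_zero.2 ((map_ne_zero _).2 ha₁0)
  have hnc₀ : 0 < normAbs E (c₀ : E) := pos_iff_ne_zero.2 ((map_ne_zero _).2 c₀.ne_zero)
  ---------------------------------------------------------------- §C the radii `ρ`, `T₀`, the scaling unit `l`, `T_k = ‖l‖^k T₀ → ∞`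
  set ρ : ℝ≥0 := normAbs E a₁ / r₁ with hρdef
  have hρ0 : 0 < ρ := div_pos hna₁ hr₁
  have hρr' : normAbs E a₁ / ρ = r₁ := by rw [hρdef, div_div_eq_mul_div, mul_comm, mul_div_assoc, div_self hna₁.ne', mul_one]
  have hρr : normAbs E a₁ / ρ ≤ r₁ := hρr'.le
  set ρ' : ℝ≥0 := normAbs E a₁ / (r₁ * normAbs E (c₀ : E)) with hρ'def
  have hρ'0 : 0 < ρ' := div_pos hna₁ (mul_pos hr₁ hnc₀)
  have hρ'r : normAbs E a₁ / ρ' = r₁ * normAbs E (c₀ : E) := by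
    rw [hρ'def, div_div_eq_mul_div, mul_comm, mul_div_assoc, div_self hna₁.ne', mul_one]
  set T₀ : ℝ≥0 := ρ + ρ' with hT₀def
  have hT₀ : 0 < T₀ := add_pos hρ0 hρ'0
  obtain ⟨l₀, hl₀, hQ₀⟩ := exists_fixed_one_lt_normAbs σ hσ hσn
  have hl₀0 : l₀ ≠ 0 := fun h => by rw [h, map_zero] at hQ₀; exact not_lt_of_ge zero_le hQ₀
  set l : Eˣ := Units.mk0 l₀ hl₀0 with hldef
  have hl : σ (l : E) = l := hl₀
  have hQ : 1 < normAbs E (l : E) := hQ₀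
  set T : ℕ → ℝ≥0 := fun k => normAbs E (l : E) ^ k * T₀ with hTdef
  have hTk : ∀ k, T₀ ≤ T k := fun k => le_mul_of_one_le_left zero_le (one_le_pow₀ hQ.le)
  have hTpos : ∀ k, 0 < T k := fun k => lt_of_lt_of_le hT₀ (hTk k)
  have hT₁ : ∀ k, normAbs E a₁ / T k ≤ r₁ := fun k =>
    calc normAbs E a₁ / T k ≤ normAbs E a₁ / ρ := div_le_div_of_nonneg_left zero_le hρ0 (le_trans le_self_add (hTk k))
      _ = r₁ := hρr'
  have hT₂ : ∀ k, normAbs E a₁ / T k ≤ r₁ * normAbs E (c₀ : E) := fun k =>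
    calc normAbs E a₁ / T k ≤ normAbs E a₁ / ρ' := div_le_div_of_nonneg_left zero_le hρ'0 (le_trans le_add_self (hTk k))
      _ = r₁ * normAbs E (c₀ : E) := hρ'r
  have hTlim : Tendsto T atTop atTop := (tendsto_pow_atTop_atTop_of_one_lt hQ).atTop_mul_const hT₀
  ---------------------------------------------------------------- §D the measures: `μ⁺`, `μ_E = (μ⁺ ⊗ μ⁻) ∘ ringDecomp⁻¹`, `μ× = ‖x‖⁻¹ dμ_E`
  set μp : Measure (fixedPart σ) := Measure.addHaar with hμp
  haveI : μp.Regular := inferInstance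
  haveI : (μp.prod μm).IsAddHaarMeasure := inferInstance
  set μE : Measure E := (μp.prod μm).map (ringDecomp σ hσ hσc).symm with hμE
  haveI : μE.IsAddHaarMeasure := ContinuousAddEquiv.isAddHaarMeasure_map (μp.prod μm) (ringDecomp σ hσ hσc).symm
  set μ' : Measure Eˣ := Measure.comap ((↑) : Eˣ → E) (μE.withDensity fun x => (((normAbs E x)⁻¹ : ℝ≥0) : ℝ≥0∞)) with hμ'
  haveI : μ'.IsHaarMeasure := LocalFieldHaar.isHaarMeasure_unitsMeasure μE
  ---------------------------------------------------------------- §E the test functions `f = 𝟙_{1+𝔭^M}` and `g_k = Φ(Re ·) 𝟙[‖Im ·‖ ≤ T_k]`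
  set f : E → ℂ := ((1 : E) +ᵥ primePowBall E (M : ℤ)).indicator fun _ => (1 : ℂ) with hfdef
  have hf : f ∈ SchwartzBruhat E := indicator_one_vadd_primePowBall_mem_schwartzBruhat (M : ℤ) 1
  have hfn : ∀ x ∈ primePowBall E 1, f x = 0 := by
    intro x hx
    rw [hfdef]
    refine Set.indicator_of_notMem (fun hx' => ?_) _
    obtain ⟨t, ht, rfl⟩ := hx'
    have ht1 : normAbs E t < 1 := lt_of_le_of_lt ht (by rw [zpow_natCast]; exact pow_lt_one₀ zero_le hq1 (by omega))
    have h1t : normAbs E ((1 : E) +ᵥ t) = 1 := by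
      rw [vadd_eq_add, LocalFieldHaar.normAbs_add_eq_of_lt (by rwa [map_one]), map_one]
    have hx1 : normAbs E ((1 : E) +ᵥ t) ≤ ((residueFieldCard E : ℝ≥0)⁻¹) ^ (1 : ℤ) := hx
    rw [h1t, zpow_one] at hx1
    exact absurd hx1 (not_le.2 hq1)
  set Φ : E → ℂ := fun a : E => ((ψ (-a) : Circle) : ℂ) * {x : E | normAbs E x ≤ ρ}.indicator (fun _ => (1 : ℂ)) a -
      ((ψ (-((c₀ : E) * a)) : Circle) : ℂ) * {x : E | normAbs E x ≤ ρ}.indicator (fun _ => (1 : ℂ)) ((c₀ : E) * a) with hΦdef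
  have hΦm : Measurable Φ := measurable_twoBump ψ hψc ρ (c₀ : E)
  have hΦb : ∀ a, ‖Φ a‖ ≤ 2 := norm_twoBump_le ψ ρ (c₀ : E)
  -- `Φ = 0` on `{‖a‖ ≤ ε}`, `ε = min (min rψ (rψ/‖c₀‖)) (min ρ (ρ/‖c₀‖))`, and off `{‖a‖ ≤ R}`, `R = max ρ (ρ/‖c₀‖)`
  set ε : ℝ≥0 := min (min rψ (rψ / normAbs E (c₀ : E))) (min ρ (ρ / normAbs E (c₀ : E))) with hεdef
  have hε : 0 < ε := lt_min (lt_min hrψ0 (div_pos hrψ0 hnc₀)) (lt_min hρ0 (div_pos hρ0 hnc₀))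
  have hΦ0' : ∀ a, normAbs E a ≤ ε → Φ a = 0 := by
    intro a ha
    have hc : normAbs E ((c₀ : E) * a) = normAbs E (c₀ : E) * normAbs E a := map_mul _ _ _
    refine twoBump_eq_zero_of_normAbs_le ψ hrψ ρ (c₀ : E) (le_trans ha (le_trans (min_le_left _ _) (min_le_left _ _))) ?_
      (le_trans ha (le_trans (min_le_right _ _) (min_le_left _ _))) ?_
    · rw [hc, mul_comm, ← le_div_iff₀ hnc₀]; exact le_trans ha (le_trans (min_le_left _ _) (min_le_right _ _))
    · rw [hc, mul_comm, ← le_div_iff₀ hnc₀]; exact le_trans ha (le_trans (min_le_right _ _) (min_le_right _ _))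
  have hΦ0 : ∀ a, normAbs E a < ε → Φ a = 0 := fun a ha => hΦ0' a ha.le
  have hΦR : ∀ a, max ρ (ρ / normAbs E (c₀ : E)) < normAbs E a → Φ a = 0 := fun a ha => twoBump_eq_zero_of_lt_normAbs ψ ρ c₀.ne_zero ha
  have hΦl : IsLocallyConstant Φ := isLocallyConstant_twoBump ψ hψ hρ0 (c₀ : E)
  -- the truncated test functions
  have hg : ∀ k, (fun x => Φ (⅟(2 : E) * (x + σ x)) * {y : E | normAbs E y ≤ T k}.indicator (fun _ => (1 : ℂ)) (⅟(2 : E) * (x - σ x))) ∈ SchwartzBruhat E :=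
    fun k => truncTest_mem_schwartzBruhat σ hσc Φ hΦl hΦR (hTpos k)
  have h12 : 0 < normAbs E (⅟(2 : E)) := pos_iff_ne_zero.2 ((map_ne_zero (normAbs E)).2 (Invertible.ne_zero (⅟(2 : E))))
  obtain ⟨n₀, hn₀⟩ := exists_pow_lt_of_lt_one (div_pos hε h12) hq1
  have hgn : ∀ k, ∀ x ∈ primePowBall E (n₀ : ℤ),
      Φ (⅟(2 : E) * (x + σ x)) * {y : E | normAbs E y ≤ T k}.indicator (fun _ => (1 : ℂ)) (⅟(2 : E) * (x - σ x)) = 0 := by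
    intro k x hx
    refine truncTest_eq_zero_of_normAbs_le σ hσ hσn Φ hΦ0' (T k) ?_
    have hx' : normAbs E x ≤ ((residueFieldCard E : ℝ≥0)⁻¹) ^ n₀ := by rw [← zpow_natCast]; exact hx
    calc normAbs E (⅟(2 : E)) * normAbs E x ≤ normAbs E (⅟(2 : E)) * ((residueFieldCard E : ℝ≥0)⁻¹) ^ n₀ := mul_le_mul_of_nonneg_left hx' zero_le
      _ ≤ ε := by rw [mul_comm, ← le_div_iff₀ h12]; exact hn₀.le
  ---------------------------------------------------------------- §F Tate's identity and the evaluation of its four factors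
  have hTate : ∀ k, tateZeta μ' f χ 0 * tateZeta μ' (fourierSB ψ μE (fun x => Φ (⅟(2 : E) * (x + σ x)) *
        {y : E | normAbs E y ≤ T k}.indicator (fun _ => (1 : ℂ)) (⅟(2 : E) * (x - σ x)))) χ⁻¹ 1 =
      tateZeta μ' (fourierSB ψ μE f) χ⁻¹ 1 * tateZeta μ' (fun x => Φ (⅟(2 : E) * (x + σ x)) *
        {y : E | normAbs E y ≤ T k}.indicator (fun _ => (1 : ℂ)) (⅟(2 : E) * (x - σ x))) χ 0 :=
    fun k => tateZeta_mul_tateZeta_fourierSB_comm_zero μE μ' hψ hχ0 hf (hg k) hfn (hgn k)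
  -- (a) `Z(f, χ, 0) = μ×(U^M) ≠ 0`
  have hZf : tateZeta μ' f χ 0 = ((μ'.real (unitFiltration E M) : ℝ) : ℂ) := tateZeta_indicator_one_vadd_primePowBall μ' hM1 hχM 0
  have hZf0 : (((μ'.real (unitFiltration E M) : ℝ) : ℂ)) ≠ 0 := by exact_mod_cast measureReal_unitFiltration_ne_zero μ' hM1
  -- (b) the dual zeta integral in closed form (★ F4c)
  have hZdual : ∀ k, tateZeta μ' (fourierSB ψ μE (fun x => Φ (⅟(2 : E) * (x + σ x)) *
        {y : E | normAbs E y ≤ T k}.indicator (fun _ => (1 : ℂ)) (⅟(2 : E) * (x - σ x)))) χ⁻¹ 1 =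
      (((μm.real {y : skewPart σ | normAbs E (y : E) ≤ T k} : ℝ) : ℂ) *
          ((μm.real {y' : skewPart σ | ∀ y : skewPart σ, normAbs E (y : E) ≤ T k → ψ ((y : E) * (y' : E)) = 1} : ℝ) : ℂ)) *
        (((μp.real {a : fixedPart σ | normAbs E (a : E) ≤ ρ} : ℝ) : ℂ) *
          ((μp.real {t : fixedPart σ | ∀ a : fixedPart σ, normAbs E (a : E) ≤ ρ → ψ ((a : E) * (t : E)) = 1} : ℝ) : ℂ) * (1 - Dbar (c₀ : E))) := by
    intro k
    rw [hμ', LocalFieldHaar.tateZeta_unitsMeasure μE]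
    have hpt : ∀ x : E, ((((normAbs E x : ℝ≥0) : ℝ) : ℂ)) ^ ((1 : ℂ) - 1) = 1 := fun x => by rw [sub_self, Complex.cpow_zero]
    simp_rw [hpt, mul_one]
    exact integral_fourierSB_truncTest_mul_eq σ hσ hσc ψ hψc hψσ μp μm ρ hρ0 c₀ hc₀ ha₁ hψa₁ Dbar hDbarm hDbarb hDbarmul hDbar1 hρr
      (hTpos k) (hT₁ k) (hT₂ k) Φ hΦdef
  -- (c) `Z(g_k, χ, 0)` as the additive integral of ★ F3
  have hZg : ∀ k, tateZeta μ' (fun x => Φ (⅟(2 : E) * (x + σ x)) * {y : E | normAbs E y ≤ T k}.indicator (fun _ => (1 : ℂ)) (⅟(2 : E) * (x - σ x))) χ 0 =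
      ∫ x, Φ (⅟(2 : E) * (x + σ x)) * ({y : E | normAbs E y ≤ T k}.indicator (fun _ => (1 : ℂ)) (⅟(2 : E) * (x - σ x))) *
        (D x * ((((normAbs E x : ℝ≥0) : ℝ) : ℂ))⁻¹) ∂μE := by
    intro k
    rw [hμ', LocalFieldHaar.tateZeta_unitsMeasure μE]
    refine integral_congr_ae (Eventually.of_forall fun x => ?_)
    dsimp only
    rw [zero_sub, Complex.cpow_neg_one, mul_assoc]
  ---------------------------------------------------------------- §G the limit `Z(g_k, χ, 0) → C_Φ · J = 0` (★ F3b, hypothesis `J = 0`)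
  have hlim := tendsto_integral_truncTest_mul σ hσ hσc hσn μp μm δ hδ Φ hΦm hΦb hε hΦ0 hΦR D hDm hDb hDmul T hTlim
  rw [hJ, mul_zero] at hlim
  have hR : Tendsto (fun k => tateZeta μ' (fourierSB ψ μE f) χ⁻¹ 1 * tateZeta μ' (fun x => Φ (⅟(2 : E) * (x + σ x)) *
        {y : E | normAbs E y ≤ T k}.indicator (fun _ => (1 : ℂ)) (⅟(2 : E) * (x - σ x))) χ 0) atTop (𝓝 0) := by
    have h := hlim.const_mul (tateZeta μ' (fourierSB ψ μE f) χ⁻¹ 1)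
    rw [mul_zero] at h
    exact h.congr fun k => by rw [hZg k]
  ---------------------------------------------------------------- §H the left side is bounded below: contradiction
  -- the positive constants
  set μB : ℝ := μp.real {a : fixedPart σ | normAbs E (a : E) ≤ ρ} with hμB
  set μA : ℝ := μp.real {t : fixedPart σ | ∀ a : fixedPart σ, normAbs E (a : E) ≤ ρ → ψ ((a : E) * (t : E)) = 1} with hμA
  have hμBpos : 0 < μB := by
    rw [hμB, measureReal_def]
    refine ENNReal.toReal_pos (ne_of_gt (lt_of_lt_of_le ((isOpen_lt (LocalFieldHaar.continuous_normAbs.comp continuous_subtype_val) continuous_const).measure_pos μp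
      ⟨0, by show normAbs E ((0 : fixedPart σ) : E) < ρ; simp [hρ0]⟩) (measure_mono fun a ha => show normAbs E (a : E) ≤ ρ from le_of_lt ha))) ?_
    exact ((isClosed_fixedPart σ hσc).isClosedEmbedding_subtypeVal.isCompact_preimage (isCompact_setOf_normAbs_le ρ)).measure_lt_top.ne
  have hμApos : 0 < μA := by
    rw [hμA, measureReal_def]
    refine ENNReal.toReal_pos (measure_ann_pos σ ψ μp hrψ0 hrψ hρ0).ne' ?_
    refine (lt_of_le_of_lt (measure_mono fun t ht => ?_)
      ((isClosed_fixedPart σ hσc).isClosedEmbedding_subtypeVal.isCompact_preimage (isCompact_setOf_normAbs_le (normAbs E a₁ / ρ))).measure_lt_top).ne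
    exact le_of_lt (ann_subset_ball σ ψ ha₁ hψa₁ hρ0 ht)
  -- the `E⁻`-factor is bounded below by `P₀ = μ⁻{‖y‖ ≤ T₀} μ⁻{‖y‖ ≤ rψ/T₀}`, the same for every `k` (★ F4c §3)
  set P₀ : ℝ := (μm {y : skewPart σ | normAbs E (y : E) ≤ T₀} * μm {y : skewPart σ | normAbs E (y : E) ≤ rψ / T₀}).toReal with hP₀
  have hballfin : ∀ r : ℝ≥0, μm {y : skewPart σ | normAbs E (y : E) ≤ r} < ⊤ := fun r =>
    ((isClosed_skewPart σ hσc).isClosedEmbedding_subtypeVal.isCompact_preimage (isCompact_setOf_normAbs_le r)).measure_lt_top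
  have hballpos : ∀ r : ℝ≥0, 0 < r → 0 < μm {y : skewPart σ | normAbs E (y : E) ≤ r} := fun r hr =>
    lt_of_lt_of_le ((isOpen_lt (LocalFieldHaar.continuous_normAbs.comp continuous_subtype_val) continuous_const).measure_pos μm
      ⟨0, by show normAbs E ((0 : skewPart σ) : E) < r; simp [hr]⟩) (measure_mono fun a ha => show normAbs E (a : E) ≤ r from le_of_lt ha)
  have hP₀pos : 0 < P₀ := by
    rw [hP₀]
    exact ENNReal.toReal_pos (mul_ne_zero (hballpos T₀ hT₀).ne' (hballpos _ (div_pos hrψ0 hT₀)).ne')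
      (ENNReal.mul_lt_top (hballfin _) (hballfin _)).ne
  have hlow : ∀ k, P₀ ≤ μm.real {y : skewPart σ | normAbs E (y : E) ≤ T k} *
      μm.real {y' : skewPart σ | ∀ y : skewPart σ, normAbs E (y : E) ≤ T k → ψ ((y : E) * (y' : E)) = 1} := by
    intro k
    have hscale := measure_skewBall_mul_measure_skewBall_eq σ hσc μm l hl hT₀ rψ k
    have hAnn : μm {y : skewPart σ | normAbs E (y : E) ≤ rψ / T k} ≤
        μm {y' : skewPart σ | ∀ y : skewPart σ, normAbs E (y : E) ≤ T k → ψ ((y : E) * (y' : E)) = 1} :=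
      measure_mono (ball_subset_skewAnn σ ψ hrψ (hTpos k))
    have hAnnfin : μm {y' : skewPart σ | ∀ y : skewPart σ, normAbs E (y : E) ≤ T k → ψ ((y : E) * (y' : E)) = 1} < ⊤ :=
      lt_of_le_of_lt (measure_mono fun y' hy' => le_of_lt (skewAnn_subset_ball σ ψ ha₁ hψa₁ (hTpos k) hy')) (hballfin _)
    rw [hP₀, ← hscale, measureReal_def, measureReal_def, ← ENNReal.toReal_mul]
    exact ENNReal.toReal_mono (ENNReal.mul_lt_top (hballfin _) hAnnfin).ne (mul_le_mul_right hAnn _)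
  -- the left side has norm `≥ μ×(U^M) · P₀ · μB · μA · 2 > 0` for every `k`
  set κ : ℝ := μ'.real (unitFiltration E M) * (P₀ * (μB * μA * 2)) with hκ
  have hUpos : 0 < μ'.real (unitFiltration E M) := lt_of_le_of_ne measureReal_nonneg (Ne.symm (measureReal_unitFiltration_ne_zero μ' hM1))
  have hκpos : 0 < κ := mul_pos hUpos (mul_pos hP₀pos (mul_pos (mul_pos hμBpos hμApos) two_pos))
  have hLHS : ∀ k, κ ≤ ‖tateZeta μ' (fourierSB ψ μE f) χ⁻¹ 1 * tateZeta μ' (fun x => Φ (⅟(2 : E) * (x + σ x)) *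
        {y : E | normAbs E y ≤ T k}.indicator (fun _ => (1 : ℂ)) (⅟(2 : E) * (x - σ x))) χ 0‖ := by
    intro k
    rw [← hTate k, hZf, hZdual k, hDbarc₀, norm_mul, Complex.norm_real, Real.norm_of_nonneg measureReal_nonneg]
    have hreal : (((μm.real {y : skewPart σ | normAbs E (y : E) ≤ T k} : ℝ) : ℂ) *
          ((μm.real {y' : skewPart σ | ∀ y : skewPart σ, normAbs E (y : E) ≤ T k → ψ ((y : E) * (y' : E)) = 1} : ℝ) : ℂ)) *
        (((μB : ℝ) : ℂ) * ((μA : ℝ) : ℂ) * (1 - (-1))) =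
        (((μm.real {y : skewPart σ | normAbs E (y : E) ≤ T k} *
          μm.real {y' : skewPart σ | ∀ y : skewPart σ, normAbs E (y : E) ≤ T k → ψ ((y : E) * (y' : E)) = 1} * (μB * μA * 2) : ℝ)) : ℂ) := by
      push_cast; ring
    rw [hreal, Complex.norm_real, Real.norm_of_nonneg (mul_nonneg (mul_nonneg measureReal_nonneg measureReal_nonneg)
      (mul_nonneg (mul_nonneg hμBpos.le hμApos.le) zero_le_two)), hκ]
    exact mul_le_mul_of_nonneg_left (mul_le_mul_of_nonneg_right (hlow k) (mul_nonneg (mul_nonneg hμBpos.le hμApos.le) zero_le_two)) hUpos.le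
  -- but the right side tends to `0`
  have hsmall : ∀ᶠ k in atTop, ‖tateZeta μ' (fourierSB ψ μE f) χ⁻¹ 1 * tateZeta μ' (fun x => Φ (⅟(2 : E) * (x + σ x)) *
        {y : E | normAbs E y ≤ T k}.indicator (fun _ => (1 : ℂ)) (⅟(2 : E) * (x - σ x))) χ 0‖ < κ :=
    (tendsto_order.1 (tendsto_norm_zero.comp hR)).2 κ hκpos
  obtain ⟨k, hk⟩ := hsmall.exists
  exact absurd (hLHS k) (not_le.2 hk)

end Summit.HodgeConjecture.HodgeConjecture.Cruxes.H413.K2E3KeysSkewLineNonvanishingLocal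

end
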